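import Summits.ResolutionOfSingularities.ResolutionOfSingularities.Theorems.SectionAscentAffineToGlobalYardstickModel
import Literature.AlgebraicGeometry.Resolution.BlowupsProduct
import HarnessLib

/-!
# Crux `AffineToGlobal` (stmt-ResolutionOfSingularities-15961), line `Sketch`: yardstick charts

Route `ResolutionOfSingularities/SectionAscent`, crux `AffineToGlobal`, line `Sketch` (regular
yardsticks), reshape 2 (phased patching). Support file
(`--supports stmt-ResolutionOfSingularities-15961`), registered stub `stub_yardstickCharts` of
the lead's skeleton — the only place where the crux's hypothesis H (affine one-shot resolutions
in characteristic `p`) is consumed, and only through its weak part "some non-zero ideal `I ⊆ A`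
with `Bl_I(Spec A)` regular" (`YardstickModel.exists_ideal_isRegular_affineBlowup`).

**Statement (`stub_yardstickCharts`).** Let `Y` be an integral scheme of finite type over a
field `K` of characteristic `p` and assume H. Then there are finitely many open charts
`φ i : T i ↪ Y` (indexed by `Fin n`) covering `Y`, blow-ups `b i : R i → T i` along ideal sheaves
`𝓘 i` with `R i` a REGULAR integral `K`-scheme of finite type (the yardsticks), and a blow-up
`σ₀ : S₀ → Y` along a non-zero ideal sheaf `J` (the join) on which every extended centre
`(𝓘 i).map (φ i)` pulls back to an effective Cartier divisor.

**Proof (global form of the landed `YardstickModel.stub_yardstickModel`).** `Y` is Noetherian;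
take a finite cover by non-empty affine opens `U i` (a finite subcover of Mathlib's
`affineCover`, indexed by points, reindexed by `Fin n` along `Fintype.equivFin`). The charts are
`T i := Spec Γ(Y, U i)` with `φ i := fromSpec`; H hands non-zero ideals `I i ⊆ Γ(Y, U i)` with
`R i := Bl_{I i}(Spec Γ(Y, U i))` regular (integral as `I i ≠ 0`, of finite type over `K` as the
blow-up is proper), `b i := affineBlowup.π`, `𝓘 i := Ĩ i` (`affineBlowup.isBlowup`). With
`J i := (𝓘 i).map (φ i)` (largest extension, restricting back to `𝓘 i` by
`Limits.comap_map_of_isOpenImmersion`, hence non-zero) put `J := ∏ i, J i ≠ 0`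
(`YardstickModel.prod_ne_bot`) and let `σ₀ : S₀ → Y` be a blow-up along `J`
(`exists_isBlowup`). Finally `σ₀⁻¹ J 𝒪 = σ₀⁻¹ (J i) 𝒪 · σ₀⁻¹ (∏_{j ≠ i} J j) 𝒪` (`comap_mul`) is
an effective Cartier divisor, hence so is the factor `σ₀⁻¹ (J i) 𝒪` (Stacks 07ZV =
`IsEffectiveCartier.of_mul_left`).

No new definitions; no statement item is restated. [cite: StacksProject, Tag 07ZV]
[cite: GortzWedhorn2020, Def. 13.90, p. 413]
-/

noncomputable section

set_option linter.dupNamespace false -- mandated namespace of this single-conjunct summit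

open CategoryTheory CategoryTheory.Limits AlgebraicGeometry TopologicalSpace
open Literature.AlgebraicGeometry.Resolution

namespace Summit.ResolutionOfSingularities.ResolutionOfSingularities.Theorems.AffineToGlobal.YardstickCharts

/-- **STUB `stub_yardstickCharts` of crux `AffineToGlobal` (stmt-ResolutionOfSingularities-15961),
line `Sketch` (reshape 2), registered signature: the yardstick charts and their join.** Assume
affine one-shot resolutions in characteristic `p` in all dimensions (the crux's hypothesis H,
written out; only its weak part is used). For `Y` integral of finite type over a field `K` of
characteristic `p` there are finitely many open charts `φ i : T i ↪ Y` covering `Y`, blow-ups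
`b i : R i → T i` along `𝓘 i` with every `R i` a regular integral `K`-scheme of finite type, and
a blow-up `σ₀ : S₀ → Y` along a non-zero ideal sheaf `J` such that every extended centre
`(𝓘 i).map (φ i)` pulls back along `σ₀` to an effective Cartier divisor. Construction (module
docstring): `T i = Spec Γ(Y, U i)` over a finite cover by non-empty affine opens,
`R i = Bl_{I i}(Spec Γ(Y, U i))` from H, `J = ∏ i, (𝓘 i).map (φ i)`, `σ₀` any blow-up along `J`;
the last clause is Stacks 07ZV (a factor of an effective Cartier product is effective Cartier).
[cite: StacksProject, Tag 07ZV] -/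
theorem stub_yardstickCharts (p : ℕ)
    (h : ∀ d : ℕ, ∀ (K : Type) [Field K] [CharP K p] (A : Type) [CommRing A] [IsDomain A]
      [Algebra K A] [Algebra.FiniteType K A], ringKrullDim A < (d : WithBot ℕ∞) →
      ∃ I : Ideal A, I ≠ ⊥ ∧
        Literature.AlgebraicGeometry.Resolution.Scheme.IsRegular
          (Literature.AlgebraicGeometry.Resolution.affineBlowup I) ∧
        ∀ 𝔭 : PrimeSpectrum A, I ≤ 𝔭.asIdeal ↔
          ¬ IsRegularLocalRing (Localization.AtPrime 𝔭.asIdeal))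
    (K : Type) [Field K] [CharP K p] (Y : Scheme.{0}) [IsIntegral Y] (f : Y ⟶ Spec (.of K))
    [LocallyOfFiniteType f] [QuasiCompact f] :
    ∃ (n : ℕ) (T R : Fin n → Scheme.{0}) (φ : ∀ i, T i ⟶ Y) (_ : ∀ i, IsOpenImmersion (φ i))
      (b : ∀ i, R i ⟶ T i) (𝓘 : ∀ i, (T i).IdealSheafData) (fR : ∀ i, R i ⟶ Spec (.of K))
      (_ : ∀ i, IsIntegral (R i)) (_ : ∀ i, LocallyOfFiniteType (fR i))
      (_ : ∀ i, QuasiCompact (fR i)) (S₀ : Scheme.{0}) (σ₀ : S₀ ⟶ Y) (J : Y.IdealSheafData),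
      (∀ y : Y, ∃ i, y ∈ Set.range (φ i)) ∧ (∀ i, IsBlowup (b i) (𝓘 i)) ∧
      (∀ i, Scheme.IsRegular (R i)) ∧ J ≠ ⊥ ∧ IsBlowup σ₀ J ∧
      ∀ i, IsEffectiveCartier (((𝓘 i).map (φ i)).comap σ₀) := by
  classical
  haveI : IsLocallyNoetherian Y := LocallyOfFiniteType.isLocallyNoetherian f
  haveI : CompactSpace Y := QuasiCompact.compactSpace_of_compactSpace f
  haveI : IsNoetherian Y := {}
  -- a finite cover of `Y` by non-empty affine opens `U i`, indexed by `Fin n`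
  let 𝒰 := Y.affineCover.finiteSubcover
  let n : ℕ := Fintype.card 𝒰.I₀
  let e : 𝒰.I₀ ≃ Fin n := Fintype.equivFin 𝒰.I₀
  let U : Fin n → Y.Opens := fun i => (𝒰.f (e.symm i)).opensRange
  have hU : ∀ i, IsAffineOpen (U i) := fun i => isAffineOpen_opensRange (𝒰.f (e.symm i))
  have hmem : ∀ i : Fin n, (e.symm i).1 ∈ U i := fun i => Y.affineCover.covers (e.symm i).1
  haveI : ∀ i, Nonempty (U i) := fun i => ⟨⟨(e.symm i).1, hmem i⟩⟩
  have hcover : ∀ y : Y, ∃ i, y ∈ U i := fun y => by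
    have hy : y ∈ (⊤ : Y.Opens) := trivial
    rw [← 𝒰.iSup_opensRange, Opens.mem_iSup] at hy
    obtain ⟨j, hj⟩ := hy
    refine ⟨e j, ?_⟩
    have hj' : e.symm (e j) = j := e.symm_apply_apply j
    change y ∈ (𝒰.f (e.symm (e j))).opensRange
    rw [hj']
    exact hj
  -- chartwise one-shots `R i = Bl_{I i}(Spec Γ(Y, U i))` (hypothesis H, weak part)
  choose I hI hreg using fun i =>
    YardstickModel.exists_ideal_isRegular_affineBlowup p h K Y f (U i) (hU i)
  -- the charts `φ i`, the centres `𝓘 i = Ĩ_i` and their largest extensions `Jc i` to `Y`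
  let φ : ∀ i, Spec Γ(Y, U i) ⟶ Y := fun i => (hU i).fromSpec
  let 𝓘 : ∀ i, (Spec Γ(Y, U i)).IdealSheafData := fun i => affineBlowup.idealSheaf (I i)
  let Jc : Fin n → Y.IdealSheafData := fun i => (𝓘 i).map (φ i)
  have hJφ : ∀ i, (Jc i).comap (φ i) = 𝓘 i := fun i =>
    Literature.AlgebraicGeometry.Limits.comap_map_of_isOpenImmersion (φ i) (𝓘 i)
  have hJc : ∀ i, Jc i ≠ ⊥ := fun i hi => by
    have h1 := hJφ i
    rw [hi, Scheme.IdealSheafData.comap_bot] at h1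
    exact affineBlowup.idealSheaf_ne_bot (hI i) h1.symm
  -- the join: `J = ∏ Jc i ≠ 0` and a blow-up `σ₀ : S₀ → Y` along it
  let J : Y.IdealSheafData := ∏ i, Jc i
  have hJ : J ≠ ⊥ := YardstickModel.prod_ne_bot Finset.univ Jc fun i _ => hJc i
  obtain ⟨S₀, σ₀, hσ₀⟩ := exists_isBlowup Y J
  -- the yardsticks `R i` are regular integral `K`-schemes of finite type
  haveI : ∀ i, IsNoetherianRing Γ(Y, U i) := fun i =>
    IsLocallyNoetherian.component_noetherian ⟨U i, hU i⟩
  have hint : ∀ i, IsIntegral (affineBlowup (I i)) := fun i => affineBlowup.isIntegral (hI i)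
  let fR : ∀ i, affineBlowup (I i) ⟶ Spec (.of K) := fun i => affineBlowup.π (I i) ≫ φ i ≫ f
  have hft : ∀ i, LocallyOfFiniteType (fR i) := fun i => inferInstance
  have hqc : ∀ i, QuasiCompact (fR i) := fun i => inferInstance
  -- on the join every extended centre becomes an effective Cartier divisor (Stacks 07ZV)
  have hcart : ∀ i, IsEffectiveCartier ((Jc i).comap σ₀) := fun i => by
    have hJi : J = Jc i * ∏ j ∈ Finset.univ.erase i, Jc j :=
      (Finset.mul_prod_erase Finset.univ Jc (Finset.mem_univ i)).symm
    have h1 : IsEffectiveCartier (J.comap σ₀) := hσ₀.isEffectiveCartier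
    rw [hJi, comap_mul] at h1
    exact h1.of_mul_left
  refine ⟨n, fun i => Spec Γ(Y, U i), fun i => affineBlowup (I i), φ, fun i => inferInstance,
    fun i => affineBlowup.π (I i), 𝓘, fR, hint, hft, hqc, S₀, σ₀, J, fun y => ?_,
    fun i => affineBlowup.isBlowup (I i), hreg, hJ, hσ₀, hcart⟩
  -- the charts cover `Y`
  obtain ⟨i, hi⟩ := hcover y
  refine ⟨i, ?_⟩
  change y ∈ Set.range (hU i).fromSpec
  rw [(hU i).range_fromSpec]
  exact hi

end Summit.ResolutionOfSingularities.ResolutionOfSingularities.Theorems.AffineToGlobal.YardstickCharts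

end
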